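import Literature.MathematicalPhysics.QuantumFieldTheory.Balaban1983to89.B7ConclConcrete
import Literature.MathematicalPhysics.QuantumFieldTheory.Balaban1983to89.B7Prop2SpecialUnitary
import Literature.MathematicalPhysics.QuantumFieldTheory.Balaban1983to89.B7Prop6FirstClause

/-!
# `Balaban1983to89.B7ConclSubgroup` — T. Bałaban, *Averaging operations for lattice gauge theories*, Commun. Math. Phys. **98** (1985) 17–51
[Balaban1985Averaging]: **the leaf `B7.Concl` (Props. 1–10 AS TYPED) at the lineage's concrete `ℤᵈ` carriers READ AT ANY SUBGROUP `G` of an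
average-closed gauge group — in particular at the paper's `G = SU(N) ⊂ M_N(ℂ)` for EVERY `N ≥ 1` — with the printed `N`-independent constants;
and why this does NOT contradict the `N`-dependence of the radius at which the averages are `SU(N)`-valued**

statement-level skeleton of published theorems with citation tags; proofs where landed; nothing here is a claim about the Yang–Mills mass gap

CITATION HEADER (lean-in-tree rule).  Cell `pub-ymgap`, seat `pub-ymgap-dag-n04-a` (Track A node N04, KNIT-BY-NAME; HUMAN RULING D-0062), 2026-08-25.
THEOREMS ONLY; kernel bookkeeping over the lineages' instance theorems (`B7ConclOneStep` p1 ∕ p3, `B7Prop2Explicit` p2, `B7ConclKExp` p4–p7,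
`B7ConclGauge` p8–p10, assembled in `B7ConclConcrete.concl_concrete` at `G = U(𝔸)`), cited BY NAME; no new estimate.

THE OBSERVATION (located item «gauge group of the [Balaban1985Averaging] group of record», node00-def's `Node00.B7GaugeGroup`, YM-PLAN §2b row N04 caveat
(2) «13 ≤ N: `AvgClosedAt` form of Props. 4–7 first missing»).  In the five concrete carrier families the gauge group `G` is read ONLY ON THE HYPOTHESIS
SIDE: `B7Prop2Explicit.concreteKStep d 𝔸 G L k` restricts the configuration type to `G`-valued configurations, and `B7ConclKExp.concreteKExp 𝔸 G L` adds the
guard `grpDefect G` («`U₀` is `G`-valued») to the small-field functional `plaqDevEta` of (52); every CONCLUSION-side field ((54) `avgDevK`; (127) ∕ (134)–(135)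
`IsAnalyticQk`, `remCk`; (156)–(157) `dQk`, `dCk`; (158) `pert`; (164) `avgRatioDev`; Prop. 7's `IsJointlyAnalytic`) is `G`-free, and the one-step and gauge
families do not read `G` at all.  Hence each typed proposition is ANTITONE in `G`: if it holds with the carriers read at `G′` it holds, WITH THE SAME
CONSTANTS, with the carriers read at any `G ≤ G′` (§1–§2: `prop2Printed_concrete_of_le`, `prop4Printed_K_of_le` … `prop7Printed_K_of_le`, and, for the
FIRST CLAUSE of Prop. 6 typed by r04's `B7Prop6FirstClause` over `KExpA` — pub-ymgap ref-A's located caveat (c1) on node N04 —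
`prop6PrintedFull_K_of_le`).  Consequently
(§3) `B7.Concl` AS TYPED holds at the carriers read at ANY subgroup of an `AvgClosed` group (`concl_of_le_avgClosed`), at any subgroup of the unitary group
`U(𝔸)` of a C⋆-algebra (`concl_of_le_unitaryUnits`), and at `SU(N) ⊂ M_N(ℂ)` with the operator norm (19) for EVERY `N ≥ 1` (`concl_specialUnitary`) —
removing the restriction `N ≤ 12` of `Node00.B7GaugeGroup.b7Concl_specialUnitary` (which routes through the closure of `SU(N)` under (42) at radius `¼`,
`AvgClosed`, refuted for `N ≥ 26` by `B7Prop2SpecialUnitary.not_avgClosed_specialUnitary`); likewise Prop. 6 WITH ITS FIRST CLAUSE at `SU(N)`, every `N`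
(`prop6PrintedFull_specialUnitary`).

HONEST FRAMING — WHAT THIS IS NOT (§4, kernel).  The printed averages (42)–(43) of a `G`-valued configuration are TACITLY `G`-valued (p. 20: «The group `G` is
obtained by applying the function `e^{iA}` to `A ∈ 𝔤`»); that property is NOT a conjunct of any typed `B7.Prop{k}Printed` (whose conclusions are norm bounds and
analyticity statements), and for `G = SU(N)` it FAILS at every `N`-independent threshold: b07's `B7Prop2SpecialUnitary.avg_not_specialUnitary_valued` (an
`SU(N)`-valued configuration on `ℤ²` satisfying (52) whose one-step average has determinant `−1`, `N ≥ 10`, `α₀N > 8π`).  So «Props. 1–10 AS TYPED hold at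
the `SU(N)`-read carriers for all `N`» (here) and «the k-fold averages of `SU(N)`-valued small fields are `SU(N)`-valued only below an `N`-dependent threshold»
(b07) are both kernel facts; `concl_specialUnitary_and_caveat` records them side by side.  One finite T⁴ programme downstream; nothing continuum ∕ infinite
volume ∕ OS ∕ mass gap ∕ Clay.  DECLARATIONS: theorems only.

[cite: Balaban1985Averaging, Props. 1–2 p.26, Prop. 3 p.36, Prop. 4 pp.38–39, Prop. 5 p.42, Props. 6–7 p.43, Prop. 8 p.45, Prop. 9 p.49, Prop. 10 p.50, p.18 and p.20 (the gauge group)]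
-/

noncomputable section

namespace Literature.MathematicalPhysics.QuantumFieldTheory.Balaban1983to89.B7ConclSubgroup

open B7Prop1Explicit B7Prop2Explicit B7Prop2SpecialUnitary B7ConclOneStep B7ConclKExp B7ConclGauge B7ConclConcrete
open B7Prop6FirstClause (KExpA Prop6PrintedFull concreteKExpA prop6PrintedFull_K)

-- `Site` alone would resolve to the torus sites of `Setup.lean`; re-export the `ℤ^d` sites of `B7Prop1Explicit`.
export B7Prop1Explicit (Site)

variable {d : ℕ}

/-! ## §1 The gauge group enters the carriers on the hypothesis side only, antitonely -/

section Mono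

variable {𝔸 : Type} [NormedRing 𝔸] {G G' : Subgroup 𝔸ˣ}

/-- **The `G`-valuedness guard is antitone in `G`**: for `G ≤ G′`, `grpDefect G′ U ≤ grpDefect G U` (a `G`-valued configuration is `G′`-valued).
[cite: Balaban1985Averaging, (52) p.26, p.18 («values in a Lie subgroup G of a unitary group U(N)»; bookkeeping)] -/
theorem grpDefect_anti (h : G ≤ G') (U : Site d → Fin d → 𝔸ˣ) : grpDefect G' U ≤ grpDefect (d := d) G U := by
  by_cases hU : ∀ (x : Site d) (κ : Fin d), U x κ ∈ G
  · rw [grpDefect_of_mem hU, grpDefect_of_mem fun x κ => h (hU x κ)]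
  · rw [grpDefect_of_not_mem hU]
    by_cases hU' : ∀ (x : Site d) (κ : Fin d), U x κ ∈ G'
    · rw [grpDefect_of_mem hU']; norm_num
    · rw [grpDefect_of_not_mem hU']

variable [NormedAlgebra ℂ 𝔸] [CompleteSpace 𝔸]

/-- **The small-field functional (52) of the k-fold expansion family is antitone in the gauge group**: `plaqDevEta` read at `G′` is `≤` `plaqDevEta` read at
`G ≤ G′` (same `η⁻²·sup_p|U(∂p) − 1|`, smaller guard). [cite: Balaban1985Averaging, (52) p.26 (bookkeeping over the r04 carrier `concreteKExp`)] -/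
theorem kExp_plaqDevEta_anti (h : G ≤ G') (L : ℕ) (i : KIdx d) (U : Site d → Fin d → 𝔸ˣ) :
    (concreteKExp 𝔸 G' (d := d) L i).plaqDevEta U ≤ (concreteKExp 𝔸 G (d := d) L i).plaqDevEta U := by
  show pdev U * ((L : ℝ) ^ i.k) ^ 2 + grpDefect G' U ≤ pdev U * ((L : ℝ) ^ i.k) ^ 2 + grpDefect G U
  have hmono := grpDefect_anti (d := d) h U
  linarith

/-! ## §2 The typed propositions transfer from `G′` to any `G ≤ G′`, constants unchanged -/

/-- **Proposition 2 (52)–(54) AS TYPED restricts to subgroups**: the k-fold family at `G ≤ G′` is the `G′`-family restricted to `G`-valued configurations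
(conclusion (54) is the same norm bound). [cite: Balaban1985Averaging, Prop. 2 (52)–(54) p.26] -/
theorem prop2Printed_concrete_of_le (h : G ≤ G') (L : ℕ) {C₀ c₂' : ℝ}
    (h2 : B7.Prop2Printed C₀ c₂' (fun k : ℕ => concreteKStep d 𝔸 G' L k)) :
    B7.Prop2Printed C₀ c₂' (fun k : ℕ => concreteKStep d 𝔸 G L k) := by
  intro k α₀ hα₀ hαc U hU
  obtain ⟨V, hV⟩ := U
  have h' := h2 k α₀ hα₀ hαc ⟨V, fun x κ => h (hV x κ)⟩
  simp only [concreteKStep] at hU h' ⊢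
  exact h' hU

/-- **Proposition 4 (134)–(135) AS TYPED transfers to subgroups** (same `C₂`, `c₄`): the hypothesis `plaqDevEta U₀ < α₀` at `G` implies it at `G′`; the
conclusion (analyticity of `Q_k`, the bound on `C_k`) does not read the gauge group. [cite: Balaban1985Averaging, Prop. 4 (134)–(135) pp.38–39] -/
theorem prop4Printed_K_of_le (h : G ≤ G') (L : ℕ) (h4 : B7.Prop4Printed (concreteKExp 𝔸 G' (d := d) L)) :
    B7.Prop4Printed (concreteKExp 𝔸 G (d := d) L) := by
  obtain ⟨C₂, c₄, hC₂, hc₄, H⟩ := h4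
  exact ⟨C₂, c₄, hC₂, hc₄, fun i α₀ α₁ hα₀ hα₀c hα₁ hα₁c U₀ hdev =>
    H i α₀ α₁ hα₀ hα₀c hα₁ hα₁c U₀ ((kExp_plaqDevEta_anti h L i U₀).trans_lt hdev)⟩

/-- **Proposition 5 (156)–(157) AS TYPED transfers to subgroups** (same `C′₁`, `C₃`, `c₅`). [cite: Balaban1985Averaging, Prop. 5 (156)–(157) p.42] -/
theorem prop5Printed_K_of_le (h : G ≤ G') (L : ℕ) (h5 : B7.Prop5Printed (concreteKExp 𝔸 G' (d := d) L)) :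
    B7.Prop5Printed (concreteKExp 𝔸 G (d := d) L) := by
  obtain ⟨C₁', C₃, c₅, hC₁', hC₃, hc₅, H⟩ := h5
  exact ⟨C₁', C₃, c₅, hC₁', hC₃, hc₅, fun i α₀ α₁ hα₀ hα₀c hα₁ hα₁c U₀ hdev =>
    H i α₀ α₁ hα₀ hα₀c hα₁ hα₁c U₀ ((kExp_plaqDevEta_anti h L i U₀).trans_lt hdev)⟩

/-- **Proposition 6 (164) AS TYPED transfers to subgroups** (same `O(1)`, same threshold). [cite: Balaban1985Averaging, Prop. 6 (164) p.43] -/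
theorem prop6Printed_K_of_le (h : G ≤ G') (L : ℕ) (h6 : B7.Prop6Printed (concreteKExp 𝔸 G' (d := d) L)) :
    B7.Prop6Printed (concreteKExp 𝔸 G (d := d) L) := by
  obtain ⟨O₁, c, hO₁, hc, H⟩ := h6
  exact ⟨O₁, c, hO₁, hc, fun i α₀ α₁ hα₀ hα₀c hα₁ hα₁c U₀ hdev =>
    H i α₀ α₁ hα₀ hα₀c hα₁ hα₁c U₀ ((kExp_plaqDevEta_anti h L i U₀).trans_lt hdev)⟩

/-- **Proposition 7 AS TYPED transfers to subgroups** (same `C₂`, same threshold; the complex-perturbed background `U′U₀` and the joint analyticity do not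
read the gauge group). [cite: Balaban1985Averaging, Prop. 7 p.43] -/
theorem prop7Printed_K_of_le (h : G ≤ G') (L : ℕ) (h7 : B7.Prop7Printed (concreteKExp 𝔸 G' (d := d) L)) :
    B7.Prop7Printed (concreteKExp 𝔸 G (d := d) L) := by
  obtain ⟨C₂, c, hC₂, hc, H⟩ := h7
  exact ⟨C₂, c, hC₂, hc, fun i α₀ α₁ hα₀ hα₀c hα₁ hα₁c U₀ hdev =>
    H i α₀ α₁ hα₀ hα₀c hα₁ hα₁c U₀ ((kExp_plaqDevEta_anti h L i U₀).trans_lt hdev)⟩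

/-- **Proposition 6 WITH ITS FIRST CLAUSE** («`(U′U₀)‾ᵏ` is an analytic function of `A′`», r04's `B7Prop6FirstClause.Prop6PrintedFull` over the extended
carrier `concreteKExpA`; pub-ymgap ref-A's located caveat (c1) on node N04) **transfers to subgroups** (same `O(1)`, same threshold): the analyticity
predicate `IsAnalyticAvg` and (164) do not read the gauge group. [cite: Balaban1985Averaging, Prop. 6 p.43 (first clause) and (164)] -/
theorem prop6PrintedFull_K_of_le (h : G ≤ G') (L : ℕ) (h6 : Prop6PrintedFull (concreteKExpA 𝔸 G' (d := d) L)) :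
    Prop6PrintedFull (concreteKExpA 𝔸 G (d := d) L) := by
  obtain ⟨O₁, c, hO₁, hc, H⟩ := h6
  exact ⟨O₁, c, hO₁, hc, fun i α₀ α₁ hα₀ hα₀c hα₁ hα₁c U₀ hdev =>
    H i α₀ α₁ hα₀ hα₀c hα₁ hα₁c U₀ ((kExp_plaqDevEta_anti h L i U₀).trans_lt hdev)⟩

end Mono

/-! ## §3 The leaf at any subgroup of an average-closed group, at any subgroup of `U(𝔸)`, and at `SU(N)` for every `N` -/

section Leaf

variable (𝔸 : Type) [CStarAlgebra 𝔸] [Nontrivial 𝔸]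

/-- **`B7.Concl` (Props. 1–10 AS TYPED) at the concrete carriers read at ANY subgroup `G` of a gauge group `G′` closed under the average (42) at radius `¼`**
(`AvgClosed d L G′`), every `d`, every `L ≥ 2`, every non-trivial C⋆-algebra `𝔸`, with the printed constants `c₂ = min{1/(3C₀), ½c₂′}`, `C₀ = 14464(d+1)²(d+4)²`,
`c₂′ = 1/(512(d+1)(d+4)L²)`: Props. 1, 3, 8, 9, 10 do not read `G`; Props. 2, 4–7 are the `G′`-instances of the lineage (`prop2Printed_concrete`, `prop4Printed_K`
… `prop7Printed_K` at `hG′`) transferred to `G` by §2. [cite: Balaban1985Averaging, Props. 1–2 p.26, Prop. 3 p.36, Prop. 4 pp.38–39, Prop. 5 p.42, Props. 6–7 p.43, Prop. 8 p.45, Prop. 9 p.49, Prop. 10 p.50 (kernel versions of the lit-balaban r04 ∕ b07 lineages, assembled at G ≤ G′)] -/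
theorem concl_of_le_avgClosed (d L : ℕ) (hL : 2 ≤ L) {G G' : Subgroup 𝔸ˣ} (hG' : AvgClosed d L G') (h : G ≤ G') :
    B7.Concl (L : ℝ) (cB d L) (C0 d) (c2' d L)
      (concreteOneStepBD 𝔸 (d := d) L)
      (fun k : ℕ => concreteKStep d 𝔸 G L k)
      (concreteKExp 𝔸 G (d := d) L)
      (concreteGaugeData 𝔸 (d := d) L)
      (concreteGaugeOneStep 𝔸 (d := d) L) :=
  have hL1 : 1 ≤ L := le_trans (by norm_num) hL
  { p1 := prop1Printed_BD L hL1
    p2 := prop2Printed_concrete_of_le h L (prop2Printed_concrete L hL hG')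
    p3 := prop3Printed_BD L hL1 (cB_pos d hL1)
    p4 := prop4Printed_K_of_le h L (prop4Printed_K L hL hG')
    p5 := prop5Printed_K_of_le h L (prop5Printed_K L hL hG')
    p6 := prop6Printed_K_of_le h L (prop6Printed_K L hL hG')
    p7 := prop7Printed_K_of_le h L (prop7Printed_K L hL hG')
    p8 := prop8Printed_G L hL
    p9 := prop9Printed_G L hL1
    p10 := prop10Printed_G L hL }

/-- **`B7.Concl` AS TYPED at the carriers read at ANY subgroup `G` of the unitary group `U(𝔸)` of a C⋆-algebra** (`B7Prop2Explicit.avgClosed_unitaryUnits`;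
print p. 18: «a Lie subgroup `G` of a unitary group `U(N)`», `𝔸 = M_N(ℂ)`), printed constants. [cite: Balaban1985Averaging, Props. 1–10 pp.26–50, p.18 (kernel version at any G ≤ U(𝔸))] -/
theorem concl_of_le_unitaryUnits (d L : ℕ) (hL : 2 ≤ L) {G : Subgroup 𝔸ˣ} (h : G ≤ unitaryUnits 𝔸) :
    B7.Concl (L : ℝ) (cB d L) (C0 d) (c2' d L)
      (concreteOneStepBD 𝔸 (d := d) L)
      (fun k : ℕ => concreteKStep d 𝔸 G L k)
      (concreteKExp 𝔸 G (d := d) L)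
      (concreteGaugeData 𝔸 (d := d) L)
      (concreteGaugeOneStep 𝔸 (d := d) L) :=
  concl_of_le_avgClosed 𝔸 d L hL (avgClosed_unitaryUnits d L) h

/-- **Prop. 6 with both clauses at the carriers read at any subgroup `G` of an `AvgClosed` group `G′`** (`L ≥ 2`): r04's `prop6PrintedFull_K` at `G′`,
transferred. [cite: Balaban1985Averaging, Prop. 6 p.43 (first clause) and (164) (kernel version of the lit-balaban r04 lineage at G ≤ G′)] -/
theorem prop6PrintedFull_of_le_avgClosed (d L : ℕ) (hL : 2 ≤ L) {G G' : Subgroup 𝔸ˣ} (hG' : AvgClosed d L G') (h : G ≤ G') :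
    Prop6PrintedFull (concreteKExpA 𝔸 G (d := d) L) :=
  prop6PrintedFull_K_of_le h L (prop6PrintedFull_K L hL hG')

end Leaf

section SpecialUnitary

open scoped Matrix.Norms.L2Operator

/-- **`B7.Concl` (Props. 1–10 AS TYPED) for `SU(N)`-valued configurations, `𝔸 = M_N(ℂ)` with the operator norm (19), EVERY `N ≥ 1`, every `d`, every
`L ≥ 2`, with the PRINTED `N`-independent constants** — the statement of `Node00.B7GaugeGroup.b7Concl_specialUnitary` WITHOUT its hypothesis `N ≤ 12`: by
`concl_of_le_unitaryUnits` at `SU(N) ≤ U(N)` (`B7Prop2SpecialUnitary.specialUnitaryUnits_le_unitaryUnits`).  See §4 for what this does NOT say.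
[cite: Balaban1985Averaging, Props. 1–10 pp.26–50, setting pp.18–21 (17)–(19) (kernel version; SU(N), every N)] -/
theorem concl_specialUnitary (N : ℕ) [NeZero N] (d L : ℕ) (hL : 2 ≤ L) :
    letI : CStarAlgebra (Matrix (Fin N) (Fin N) ℂ) := {}
    B7.Concl (L : ℝ) (cB d L) (C0 d) (c2' d L)
      (concreteOneStepBD (Matrix (Fin N) (Fin N) ℂ) (d := d) L)
      (fun k : ℕ => concreteKStep d (Matrix (Fin N) (Fin N) ℂ) (specialUnitaryUnits (Fin N)) L k)
      (concreteKExp (Matrix (Fin N) (Fin N) ℂ) (specialUnitaryUnits (Fin N)) (d := d) L)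
      (concreteGaugeData (Matrix (Fin N) (Fin N) ℂ) (d := d) L)
      (concreteGaugeOneStep (Matrix (Fin N) (Fin N) ℂ) (d := d) L) := by
  letI : CStarAlgebra (Matrix (Fin N) (Fin N) ℂ) := {}
  exact concl_of_le_unitaryUnits (Matrix (Fin N) (Fin N) ℂ) d L hL specialUnitaryUnits_le_unitaryUnits

/-- **Prop. 6 WITH ITS FIRST CLAUSE for `SU(N)`-valued backgrounds, every `N ≥ 1`** (`𝔸 = M_N(ℂ)`, operator norm; `O(1) = 200(d+1)`, threshold `cK d L`):
`prop6PrintedFull_of_le_avgClosed` at `SU(N) ≤ U(N)`. [cite: Balaban1985Averaging, Prop. 6 p.43 (first clause) and (164) (kernel version; SU(N), every N)] -/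
theorem prop6PrintedFull_specialUnitary (N : ℕ) [NeZero N] (d L : ℕ) (hL : 2 ≤ L) :
    letI : CStarAlgebra (Matrix (Fin N) (Fin N) ℂ) := {}
    Prop6PrintedFull (concreteKExpA (Matrix (Fin N) (Fin N) ℂ) (specialUnitaryUnits (Fin N)) (d := d) L) := by
  letI : CStarAlgebra (Matrix (Fin N) (Fin N) ℂ) := {}
  exact prop6PrintedFull_of_le_avgClosed (Matrix (Fin N) (Fin N) ℂ) d L hL (avgClosed_unitaryUnits d L)
    specialUnitaryUnits_le_unitaryUnits

/-! ## §4 What the typed leaf at `SU(N)` does NOT say: the averages of `SU(N)`-valued small fields are not `SU(N)`-valued below any `N`-independent threshold -/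

/-- **Both kernel facts side by side.**  (i) For every `N ≥ 1`: Props. 1–10 AS TYPED hold at the `SU(N)`-read carriers on `ℤ²` with block size `L = 2` and the
printed constants (`concl_specialUnitary`).  (ii) For every `N ≥ 10` and every threshold `α₀` with `α₀N > 8π`: there is an `SU(N)`-valued configuration on `ℤ²`
satisfying the small-field hypothesis (52) at `k = 1`, `L = 2` whose one-step average (43) is NOT `SU(N)`-valued (b07's `avg_not_specialUnitary_valued`: the
central twist `e^{2πi/N}·1`, average of determinant `−1`).  The tacit printed `G`-valuedness of the averages (p. 20) is thus no part of the typed leaf and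
needs the `N`-dependent radius of `B7Prop2SpecialUnitary` (`avgClosedAt_specialUnitary`: `t ≤ ¼`, `Nt < π`).
[cite: Balaban1985Averaging, Props. 1–10 pp.26–50; p.20 («The group G is obtained by applying the function e^{iA} to A ∈ 𝔤»); Prop. 2 (52)–(54) p.26 (kernel facts of the lineages, juxtaposed)] -/
theorem concl_specialUnitary_and_caveat (N : ℕ) [NeZero N] (hN : 10 ≤ N) {α₀ : ℝ} (hα : 8 * Real.pi < α₀ * N) :
    letI : CStarAlgebra (Matrix (Fin N) (Fin N) ℂ) := {}
    B7.Concl ((2 : ℕ) : ℝ) (cB 2 2) (C0 2) (c2' 2 2)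
      (concreteOneStepBD (Matrix (Fin N) (Fin N) ℂ) (d := 2) 2)
      (fun k : ℕ => concreteKStep 2 (Matrix (Fin N) (Fin N) ℂ) (specialUnitaryUnits (Fin N)) 2 k)
      (concreteKExp (Matrix (Fin N) (Fin N) ℂ) (specialUnitaryUnits (Fin N)) (d := 2) 2)
      (concreteGaugeData (Matrix (Fin N) (Fin N) ℂ) (d := 2) 2)
      (concreteGaugeOneStep (Matrix (Fin N) (Fin N) ℂ) (d := 2) 2) ∧
    ∃ U : Site 2 → Fin 2 → (Matrix (Fin N) (Fin N) ℂ)ˣ,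
      (∀ x κ, U x κ ∈ specialUnitaryUnits (Fin N)) ∧ pdev U < α₀ * ((((2 : ℕ) : ℝ) ^ 1)⁻¹) ^ 2 ∧
        avgIter 2 U 1 0 0 ∉ specialUnitaryUnits (Fin N) := by
  letI : CStarAlgebra (Matrix (Fin N) (Fin N) ℂ) := {}
  exact ⟨concl_specialUnitary N 2 2 le_rfl, twistCfg N, avg_not_specialUnitary_valued hN hα⟩

end SpecialUnitary

end Literature.MathematicalPhysics.QuantumFieldTheory.Balaban1983to89.B7ConclSubgroup

end
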